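import Summits.Ventures.Crystal3D.Theorems.StickyWulffConstantCoaxialWallLawWordRigidity
import HarnessLib

/-!
# No well-formed word of an IN-PLANE-ROOTED automaton carries the top grain's slots (twin pairs)

HONEST FRAMING. Part of the venture `Summits/Ventures/Crystal3D` (cell `crystal3d-full`), helper for the crux
`CoaxialWallLaw` (stmt-Ventures-19481) of `route-Ventures-StickyWulffConstant`, REGISTERED line `WallLedgerF`
(planner cf-p1 gen 16), open stub `stub_coaxialTwoSlabAdhesion` (general fillings).  The rigidity input `hnotop`
of `word_sources_le_of_noTopClass` (`…CoaxialWallLawWordCoreNoTop`, the band-free NET count) for the IN-PLANE-ROOTED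
word automaton of a TWIN pair (memo F-FRONTIER-g5 §4(a′), evidence on the crux item).  Setting = the word classes
of 19481-p2's `…CoaxialWallLawWordLetters` / `…WordRigidity` (frames `F (μ :: κ) = F κ ∘ R_μ`, model directions
`u (μ :: κ) = −u κ`, well-formedness `WF`: each pushed letter is a unit model menu normal `μ` with
`⟪u κ', μ⟫ = +√(2/3)`, never the antipode of the head).  Rung credit only; F-C1 not moved.

* `word_image_ne_mirror_of_inner_zero` — if the ROOT direction is orthogonal to a unit model menu normal `m`
  (`⟪u [], m⟫ = 0`: the root slot is IN-PLANE for `m`), then no well-formed word `κ` has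
  `F κ '' fccSlots = (F [] ∘ R_m) '' fccSlots`.  Proof: otherwise the mirror chain `κ ++ [m]` maps the slots
  into the slots; it is a `±1/3`-chain of unit model menu normals (inside `κ` by `word_letters_of_wf`; at the
  junction the deepest letter `a` of `κ` has `⟪u [], a⟫ = +√(2/3)`, so `a ≠ ±m`, hence `⟪a, m⟫ = ±1/3` by
  `inner_menuNormals`), contradicting `foldl_reflect_slots_false` (NonReturn).
* `word_noTop_of_inner_zero` — triangle form: for a frame `G₂` with `G₂ '' fccSlots = (F [] ∘ R_m) '' fccSlots`
  (the top grain of a twin pair: `Λ₂`'s slot dozen is the mirror of `Λ₁`'s across the lamination plane), no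
  well-formed word has a `60°` triangle of its slots inside `G₂ '' fccSlots` (`image_fccSlots_eq_of_triangle`).
  This is literally the hypothesis `hnotop` of `word_sources_le_of_noTopClass` with `K = {κ // WF κ}`.

WHAT THIS IS NOT: not the stub; the state set, the move map and the assembly are not here; translation pairs are
NOT covered (their top grain is the root class up to a coset); F-C1 not moved.
-/

noncomputable section

namespace Summit.Ventures.Crystal3D.Theorems

open Summit.Ventures.Crystal3D Finset
open Literature.MathematicalPhysics.StatisticalMechanics (fccStacking)
open scoped InnerProductSpace

section NoTop

variable {F : List (EuclideanSpace ℝ (Fin 3)) → (EuclideanSpace ℝ (Fin 3) ≃ₗᵢ[ℝ] EuclideanSpace ℝ (Fin 3))}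
  {u : List (EuclideanSpace ℝ (Fin 3)) → EuclideanSpace ℝ (Fin 3)}
  {WF : List (EuclideanSpace ℝ (Fin 3)) → Prop}

/-- **No well-formed word of an in-plane-rooted automaton has the mirror slot dozen.**  See the module
docstring. -/
theorem word_image_ne_mirror_of_inner_zero
    (hFc : ∀ μ κ, F (μ :: κ) = ((ℝ ∙ μ)ᗮ.reflection).trans (F κ))
    (huc : ∀ μ κ, u (μ :: κ) = -u κ)
    (hWFc : ∀ μ κ, WF (μ :: κ) ↔ (WF κ ∧ ‖μ‖ = 1 ∧
      (∀ w ∈ fccSlots, ⟪w, μ⟫_ℝ = 0 ∨ ⟪w, μ⟫_ℝ = Real.sqrt (2 / 3) ∨ ⟪w, μ⟫_ℝ = -Real.sqrt (2 / 3)) ∧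
      ⟪u κ, μ⟫_ℝ = Real.sqrt (2 / 3) ∧ ∀ μ' κ', κ = μ' :: κ' → μ' ≠ -μ))
    {m : EuclideanSpace ℝ (Fin 3)} (hm : ‖m‖ = 1)
    (hmenu : ∀ w ∈ fccSlots, ⟪w, m⟫_ℝ = 0 ∨ ⟪w, m⟫_ℝ = Real.sqrt (2 / 3) ∨ ⟪w, m⟫_ℝ = -Real.sqrt (2 / 3))
    (horth : ⟪u [], m⟫_ℝ = 0)
    {κ : List (EuclideanSpace ℝ (Fin 3))} (hκ : WF κ) :
    (F κ : EuclideanSpace ℝ (Fin 3) → EuclideanSpace ℝ (Fin 3)) '' ↑fccSlots ≠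
      (fun x => F [] (x - (2 * ⟪x, m⟫_ℝ) • m)) '' ↑fccSlots := by
  intro himg
  have hr : 0 < Real.sqrt (2 / 3) := Real.sqrt_pos.2 (by norm_num)
  obtain ⟨hlet, hchain⟩ := word_letters_of_wf huc hWFc κ hκ
  have hκu : ∀ μ ∈ κ, ‖μ‖ = 1 := fun μ hμ => (hlet μ hμ).1
  have hκ' : WF (κ ++ []) := by rw [List.append_nil]; exact hκ
  refine foldl_reflect_slots_false (κ ++ [m]) (by simp) ?_ ?_ ?_
  · -- letters
    intro μ hμ
    rcases List.mem_append.1 hμ with h | h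
    · exact hlet μ h
    · rw [List.mem_singleton] at h
      subst h
      exact ⟨hm, hmenu⟩
  · -- the chain condition, with the junction `getLast κ` — `m`
    rw [List.isChain_append]
    refine ⟨hchain, List.isChain_singleton _, ?_⟩
    intro x hx y hy
    have hy' : m = y := by simpa using hy
    subst hy'
    obtain ⟨hx1, hxm⟩ := hlet x (List.mem_of_getLast? hx)
    have hux : ⟪u [], x⟫_ℝ = Real.sqrt (2 / 3) := word_inner_u_getLast hWFc κ [] hκ' x hx
    have hmx : ∀ w ∈ fccSlots,
        ⟪(LinearIsometryEquiv.refl ℝ (EuclideanSpace ℝ (Fin 3))) w, x⟫_ℝ = 0 ∨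
        ⟪(LinearIsometryEquiv.refl ℝ (EuclideanSpace ℝ (Fin 3))) w, x⟫_ℝ = Real.sqrt (2 / 3) ∨
        ⟪(LinearIsometryEquiv.refl ℝ (EuclideanSpace ℝ (Fin 3))) w, x⟫_ℝ = -Real.sqrt (2 / 3) := by
      intro w hw; simpa using hxm w hw
    have hmy : ∀ w ∈ fccSlots,
        ⟪(LinearIsometryEquiv.refl ℝ (EuclideanSpace ℝ (Fin 3))) w, m⟫_ℝ = 0 ∨
        ⟪(LinearIsometryEquiv.refl ℝ (EuclideanSpace ℝ (Fin 3))) w, m⟫_ℝ = Real.sqrt (2 / 3) ∨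
        ⟪(LinearIsometryEquiv.refl ℝ (EuclideanSpace ℝ (Fin 3))) w, m⟫_ℝ = -Real.sqrt (2 / 3) := by
      intro w hw; simpa using hmenu w hw
    rcases inner_menuNormals (LinearIsometryEquiv.refl ℝ _) hx1 hm hmx hmy with h | h | h | h
    · -- `x = m`: but `⟪u [], x⟫ = √(2/3) ≠ 0`
      have hxm' : x = m := (inner_eq_one_iff_of_norm_eq_one (𝕜 := ℝ) hx1 hm).1 h
      rw [hxm'] at hux
      rw [hux] at horth
      exact absurd horth (ne_of_gt hr)
    · -- `m = −x`
      have hyx : m = -x := eq_neg_of_inner_eq_neg_one' hx1 hm h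
      rw [hyx, inner_neg_right, hux] at horth
      linarith
    · exact Or.inl h
    · exact Or.inr h
  · -- the chain `κ ++ [m]` maps the slots into the slots
    intro w hw
    have hmem : (F κ : EuclideanSpace ℝ (Fin 3) → EuclideanSpace ℝ (Fin 3)) w ∈
        (fun x => F [] (x - (2 * ⟪x, m⟫_ℝ) • m)) '' ↑fccSlots := by
      rw [← himg]; exact Set.mem_image_of_mem _ (Finset.mem_coe.2 hw)
    obtain ⟨w', hw', heq⟩ := hmem
    rw [Finset.mem_coe] at hw'
    have hF : F κ w = F [] (κ.foldl (fun (y : EuclideanSpace ℝ (Fin 3)) μ => y - (2 * ⟪y, μ⟫_ℝ) • μ) w) := by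
      have := word_F_append_apply hFc κ hκu [] w
      rwa [List.append_nil] at this
    simp only at heq
    rw [hF] at heq
    have heq' := (F []).injective heq
    -- `foldl R (κ ++ [m]) w = R_m (foldl R κ w) = R_m (R_m w') = w'`
    rw [List.foldl_append, List.foldl_cons, List.foldl_nil, ← heq', reflect_reflect_unit hm]
    exact hw'

/-- **Triangle form** (the hypothesis `hnotop` of `word_sources_le_of_noTopClass`): with an in-plane root, no
well-formed word has a `60°` triangle of its slots inside the slot dozen of a frame `G₂` whose slot dozen is the
mirror image `(F [] ∘ R_m) '' fccSlots`. -/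
theorem word_noTop_of_inner_zero
    (hFc : ∀ μ κ, F (μ :: κ) = ((ℝ ∙ μ)ᗮ.reflection).trans (F κ))
    (huc : ∀ μ κ, u (μ :: κ) = -u κ)
    (hWFc : ∀ μ κ, WF (μ :: κ) ↔ (WF κ ∧ ‖μ‖ = 1 ∧
      (∀ w ∈ fccSlots, ⟪w, μ⟫_ℝ = 0 ∨ ⟪w, μ⟫_ℝ = Real.sqrt (2 / 3) ∨ ⟪w, μ⟫_ℝ = -Real.sqrt (2 / 3)) ∧
      ⟪u κ, μ⟫_ℝ = Real.sqrt (2 / 3) ∧ ∀ μ' κ', κ = μ' :: κ' → μ' ≠ -μ))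
    {m : EuclideanSpace ℝ (Fin 3)} (hm : ‖m‖ = 1)
    (hmenu : ∀ w ∈ fccSlots, ⟪w, m⟫_ℝ = 0 ∨ ⟪w, m⟫_ℝ = Real.sqrt (2 / 3) ∨ ⟪w, m⟫_ℝ = -Real.sqrt (2 / 3))
    (horth : ⟪u [], m⟫_ℝ = 0)
    (G₂ : EuclideanSpace ℝ (Fin 3) ≃ₗᵢ[ℝ] EuclideanSpace ℝ (Fin 3))
    (hG₂ : (G₂ : EuclideanSpace ℝ (Fin 3) → EuclideanSpace ℝ (Fin 3)) '' ↑fccSlots =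
      (fun x => F [] (x - (2 * ⟪x, m⟫_ℝ) • m)) '' ↑fccSlots)
    {κ : List (EuclideanSpace ℝ (Fin 3))} (hκ : WF κ) :
    ¬ (∃ a ∈ fccSlots, ∃ a' ∈ fccSlots, ∃ a'' ∈ fccSlots,
        ⟪a, a'⟫_ℝ = 1 / 2 ∧ ⟪a, a''⟫_ℝ = 1 / 2 ∧ ⟪a', a''⟫_ℝ = 1 / 2 ∧
        (∃ w ∈ fccSlots, G₂ w = F κ a) ∧ (∃ w ∈ fccSlots, G₂ w = F κ a') ∧
        (∃ w ∈ fccSlots, G₂ w = F κ a'')) := by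
  rintro ⟨a, ha, a', ha', a'', ha'', i1, i2, i3, ⟨w₁, hw₁, e₁⟩, ⟨w₂, hw₂, e₂⟩, ⟨w₃, hw₃, e₃⟩⟩
  have himg := image_fccSlots_eq_of_triangle (F κ) G₂ ha ha' ha'' i1 i2 i3
    ⟨w₁, Finset.mem_coe.2 hw₁, e₁⟩ ⟨w₂, Finset.mem_coe.2 hw₂, e₂⟩ ⟨w₃, Finset.mem_coe.2 hw₃, e₃⟩
  rw [hG₂] at himg
  exact word_image_ne_mirror_of_inner_zero hFc huc hWFc hm hmenu horth hκ himg

end NoTop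

end Summit.Ventures.Crystal3D.Theorems

end
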